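import Summits.AtomisticToContinuum.BoseEinsteinCondensation.Theorems.PuffFloor.Negative.PuffFloorFalseForNearMinimisers
import Literature.MathematicalPhysics.QuantumManyBody.LiebYngvasonPoincare
import Literature.MathematicalPhysics.QuantumManyBody.LiebYngvasonLowerBound
import Literature.MathematicalPhysics.QuantumManyBody.BoseGasDirichletWall
import Summits.AtomisticToContinuum.BoseEinsteinCondensation.Theorems.LatticeToPeriodicBridge.Negative.UniformThreshold
import HarnessLib

/-!
# The fixed-volume simplicity stub at the free gas, and its load-bearing density guard (crux `HardCoreExtension`, stmt-AtomisticToContinuum-11786)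

Standing adversary of crux `HardCoreExtension` (route `BECConjugateDomination`), gen 4; landed copy of the
checked part of §13 of `Cruxes/HardCoreExtension/Disproof.lean`. Both surviving lines of the crux carry a
fixed-volume "variational simplicity" stub — S5 `stub_diluteClustering` of the picked line
`third-law-current-floor`, F `stub_slackUniformisation` of `near-minimiser-slack-transfer` — whose content at
the crux's own potential `v = hardCorePotential b` is the connectivity (mod permutations) of the dilute
hard-sphere configuration space on the torus for all large `N`, an open problem (Baryshnikov–Bubenik–Kahle,
IMRN 2014, §6; assumed as (2.1.1) in Simányi, AHP 2004). This file records the two kernel-checkable facts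
around that finding:

* `finiteness_false_without_dilute_guard` — the density guard `ρ < ρ₁(v)` of S5 (and of F, T) is
  load-bearing: "`∀ v ∀ ρ > 0 ∀ᶠ N, E₀^per(v; N, L_N) ≠ ⊤`" is FALSE (hard spheres of radius `1` at density
  `9 > 8`, tree `eventually_periodicGroundStateEnergy_hardCorePotential_eq_top`);
* `diluteClustering_holds_at_freeGas` — S5 HOLDS at `v = 0` (the body of `stub_diluteClustering` read at the
  free gas): for every `N ≥ 1` and `η > 0` the gap-scale slack `δ = π²t²/L²`, `t = min(1, η/33)`, makes any
  two `δ`-near-minimisers of the free periodic energy `η`-close in `L²(cell^N)` modulo a phase. Ingredients: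
  the parametric Poincaré step `exists_near_const_of_kinetic_le'` (tree `poincare_boxN`), the two-sided mass
  bounds `mass_bounds_of_near_const` (Young both ways), the phase alignment `norm_sub_argPhase_mul`, and
  `nearConst_cluster` (`V(|c| − |c'|)² ≤ 9t`).

No `def`; no Theses statement is asserted positively (S5 is a stub of a crux line, not a route item, and only
its `v = 0` instance is proved). Three one-line helpers of the sibling file
`HardCoreExtension.Negative.QuadraticFloorCappedFreeGas` (accepted hours ago, not yet built on the farm) are
re-derived as `private` auxiliaries. All `[folklore]`.
-/

noncomputable section

namespace Summit.AtomisticToContinuum.BoseEinsteinCondensation.Theorems.HardCoreExtension.Negative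

open Literature.MathematicalPhysics.QuantumManyBody.BoseGas MeasureTheory Filter
open Summit.AtomisticToContinuum.BoseEinsteinCondensation.Theorems.PuffFloor.Negative
open scoped ENNReal NNReal

/-! ### The density guard is load-bearing -/


/-- **The density guard of S5 / F / T is load-bearing** (S5's first conjunct WITHOUT `ρ < ρ₁(v)` is false): for
hard spheres of radius `1` at density `9 > 8`, the periodic ground-state energy on `L_N = (N/9)^{1/3}` is `⊤` for all
large `N` (pigeonhole in the cell, tree
`LatticeToPeriodicBridge.Negative.eventually_periodicGroundStateEnergy_hardCorePotential_eq_top`), so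
"`∀ v ∀ ρ > 0 ∀ᶠ N, E₀^per ≠ ⊤`" fails — and with `E₀^per = ⊤` every state is a near-minimiser, so the clustering
clause fails there too (paper: the constant state vs. a zero-mean symmetrised plane wave are at `L²`-distance `√2`
modulo every phase). [folklore] -/
theorem finiteness_false_without_dilute_guard :
    ¬ ∀ v : ℝ → ℝ≥0∞, IsRepulsiveFiniteRange v → ∀ ρ : ℝ, 0 < ρ → ∀ᶠ N : ℕ in atTop,
        periodicGroundStateEnergy v N (sideLength ρ N) ≠ ⊤ := by
  intro h
  have h1 := h (hardCorePotential 1) (isRepulsiveFiniteRange_hardCorePotential 1) 9 (by norm_num)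
  have h2 := LatticeToPeriodicBridge.Negative.eventually_periodicGroundStateEnergy_hardCorePotential_eq_top
    (a := 1) one_pos (ρ := 9) (by norm_num)
  obtain ⟨N, hN1, hN2⟩ := (h1.and h2).exists
  exact hN1 hN2


/-! ### Free near-minimisers cluster modulo a phase -/

section FreeClustering

variable {N : ℕ} {L : ℝ}

/-- Young: `‖c‖² ≤ (1+s)‖a‖² + (1+s⁻¹)‖a − c‖²` (`s > 0`). [folklore] -/
private theorem young_aux (a c : ℂ) {s : ℝ} (hs : 0 < s) :
    ‖c‖ ^ 2 ≤ (1 + s) * ‖a‖ ^ 2 + (1 + s⁻¹) * ‖a - c‖ ^ 2 := by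
  have htri : ‖c‖ ≤ ‖a‖ + ‖a - c‖ := by
    have h := norm_add_le a (c - a)
    rw [add_sub_cancel, norm_sub_rev] at h
    exact h
  have hx : 0 ≤ ‖a‖ := norm_nonneg _
  have hy : 0 ≤ ‖a - c‖ := norm_nonneg _
  have hc : 0 ≤ ‖c‖ := norm_nonneg _
  have h1 : ‖c‖ ^ 2 ≤ (‖a‖ + ‖a - c‖) ^ 2 := pow_le_pow_left₀ hc htri 2
  have h2 : (1 + s) * ‖a‖ ^ 2 + (1 + s⁻¹) * ‖a - c‖ ^ 2 - (‖a‖ + ‖a - c‖) ^ 2 =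
      s⁻¹ * (s * ‖a‖ - ‖a - c‖) ^ 2 := by
    field_simp
    ring
  have h3 : 0 ≤ s⁻¹ * (s * ‖a‖ - ‖a - c‖) ^ 2 := by positivity
  linarith

/-- `∫_{cell^N} ‖Ψ‖² = 1` (Bochner form of the normalisation). [folklore] -/
private theorem integral_normSq_one_aux (Ψ : PeriodicTrialState N L) :
    ∫ X in cellN N L, ‖Ψ.ψ X‖ ^ 2 = 1 := by
  have hint : Integrable (fun X => ‖Ψ.ψ X‖ ^ 2) (volume.restrict (cellN N L)) :=
    integrableOn_cellN_real L ((Ψ.contDiff.continuous.norm).pow 2)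
  have h := ofReal_integral_eq_lintegral_ofReal hint
    (Filter.Eventually.of_forall fun X => sq_nonneg _)
  simp_rw [← coe_nnnorm_sq_eq_ofReal] at h
  rw [Ψ.norm_eq] at h
  have hnn : 0 ≤ ∫ X in cellN N L, ‖Ψ.ψ X‖ ^ 2 := integral_nonneg fun X => sq_nonneg _
  have := congrArg ENNReal.toReal h
  rwa [ENNReal.toReal_ofReal hnn, ENNReal.toReal_one] at this

/-- For the free gas a `δ`-near-minimiser has kinetic energy `≤ δ`. [folklore] -/
private theorem kinetic_le_free_aux (hL : 0 < L) (Ψ : PeriodicTrialState N L) {δ : ℝ≥0∞}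
    (hE : periodicEnergy (0 : ℝ → ℝ≥0∞) Ψ ≤ periodicGroundStateEnergy (0 : ℝ → ℝ≥0∞) N L + δ) :
    ∫⁻ X in cellN N L, kineticDensity Ψ.ψ X ≤ δ := by
  rw [periodicGroundStateEnergy_zero_eq_zero N hL, zero_add, periodicEnergy] at hE
  refine le_trans (le_of_eq (lintegral_congr fun X => ?_)) hE
  rw [periodicInteraction_zeroPotential, zero_mul, add_zero]

/-- **Parametric Poincaré step** (cf. `exists_near_const_of_kinetic_le`, §10b): kinetic energy on the cell
`≤ (π²/L²)·κ` puts `Ψ` within `κ` of its mean in `L²(cell^N)`. [folklore] -/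
theorem exists_near_const_of_kinetic_le' (hL : 0 < L) (Ψ : PeriodicTrialState N L) {κ : ℝ} (hκ : 0 ≤ κ)
    (hT : ∫⁻ X in cellN N L, kineticDensity Ψ.ψ X ≤ ENNReal.ofReal (Real.pi ^ 2 / L ^ 2 * κ)) :
    ∃ c : ℂ, ∫ X in cellN N L, ‖Ψ.ψ X - c‖ ^ 2 ≤ κ := by
  set c : ℂ := ⨍ Y in boxN N L, Ψ.ψ Y with hc
  refine ⟨c, ?_⟩
  have hP := Poincare.poincare_boxN N L hL Ψ.ψ Ψ.contDiff
  rw [setLIntegral_congr (boxN_ae_eq_cellN N L), setLIntegral_congr (boxN_ae_eq_cellN N L)] at hP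
  have hgap : 0 < Real.pi ^ 2 / L ^ 2 := by positivity
  have hA : ∫⁻ X in cellN N L, ((‖Ψ.ψ X - c‖₊ : ℝ≥0∞)) ^ 2 ≤ ENNReal.ofReal κ := by
    have h := hP.trans hT
    rw [ENNReal.ofReal_mul hgap.le] at h
    exact (ENNReal.mul_le_mul_iff_right (ENNReal.ofReal_pos.2 hgap).ne' ENNReal.ofReal_ne_top).1 h
  have hint : Integrable (fun X => ‖Ψ.ψ X - c‖ ^ 2) (volume.restrict (cellN N L)) :=
    integrableOn_cellN_real L (((Ψ.contDiff.continuous.sub continuous_const).norm).pow 2)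
  have h := ofReal_integral_eq_lintegral_ofReal hint
    (Filter.Eventually.of_forall fun X => sq_nonneg _)
  simp_rw [← coe_nnnorm_sq_eq_ofReal] at h
  rw [← h] at hA
  exact (ENNReal.ofReal_le_ofReal_iff hκ).1 hA

/-- **Two-sided mass bounds for a near-constant state**: if `∫_{cell^N}‖Ψ − c‖² ≤ κ` (`Ψ` normalised) then for
every `s > 0`, `1 ≤ (1+s)·|c|²V + (1+s⁻¹)κ` and `|c|²V ≤ (1+s) + (1+s⁻¹)κ`, `V = L^{3N}` (pointwise Young both
ways, integrated). [folklore] -/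
theorem mass_bounds_of_near_const (hL : 0 < L) (Ψ : PeriodicTrialState N L) (c : ℂ) {κ s : ℝ}
    (hs : 0 < s) (hχ : ∫ X in cellN N L, ‖Ψ.ψ X - c‖ ^ 2 ≤ κ) :
    1 ≤ (1 + s) * (‖c‖ ^ 2 * (L ^ 3) ^ N) + (1 + s⁻¹) * κ ∧
      ‖c‖ ^ 2 * (L ^ 3) ^ N ≤ (1 + s) + (1 + s⁻¹) * κ := by
  set V : ℝ := (L ^ 3) ^ N with hVdef
  set f : Config N → ℝ := fun X => ‖Ψ.ψ X‖ ^ 2 with hf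
  set g : Config N → ℝ := fun X => ‖Ψ.ψ X - c‖ ^ 2 with hg
  have hψc : Continuous Ψ.ψ := Ψ.contDiff.continuous
  have hfc : Continuous f := (hψc.norm).pow 2
  have hgc : Continuous g := ((hψc.sub continuous_const).norm).pow 2
  have hIf : ∫ X in cellN N L, f X = 1 := integral_normSq_one_aux Ψ
  have if_ : IntegrableOn f (cellN N L) volume := integrableOn_cellN_real L hfc
  have ig : IntegrableOn g (cellN N L) volume := integrableOn_cellN_real L hgc
  have hVol : (volume : Measure (Config N)).real (cellN N L) = V := measureReal_cellN hL N
  have hfin : volume (cellN N L) ≠ ⊤ := by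
    rw [volume_cellN]; exact ENNReal.pow_ne_top (ENNReal.pow_ne_top ENNReal.ofReal_ne_top)
  set κ' : ℝ := ∫ X in cellN N L, g X with hκ'def
  have hκ' : κ' ≤ κ := hχ
  have hs1 : 0 ≤ 1 + s⁻¹ := by positivity
  have hs2 : 0 ≤ 1 + s := by positivity
  constructor
  · have hpt : ∀ X, f X ≤ (1 + s) * ‖c‖ ^ 2 + (1 + s⁻¹) * g X := fun X => by
      have hy := young_aux c (Ψ.ψ X) hs
      rw [norm_sub_rev] at hy
      exact hy
    have ic : IntegrableOn (fun _ : Config N => (1 + s) * ‖c‖ ^ 2) (cellN N L) volume :=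
      integrableOn_const hfin
    have hlin : ∫ X in cellN N L, ((1 + s) * ‖c‖ ^ 2 + (1 + s⁻¹) * g X) =
        (1 + s) * (‖c‖ ^ 2 * V) + (1 + s⁻¹) * κ' := by
      rw [integral_add ic (ig.const_mul _), setIntegral_const, integral_const_mul, hVol, smul_eq_mul]
      ring
    calc (1 : ℝ) = ∫ X in cellN N L, f X := hIf.symm
      _ ≤ ∫ X in cellN N L, ((1 + s) * ‖c‖ ^ 2 + (1 + s⁻¹) * g X) :=
          setIntegral_mono if_ (ic.add (ig.const_mul _)) hpt
      _ = (1 + s) * (‖c‖ ^ 2 * V) + (1 + s⁻¹) * κ' := hlin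
      _ ≤ (1 + s) * (‖c‖ ^ 2 * V) + (1 + s⁻¹) * κ := by gcongr
  · have hpt : ∀ X, ‖c‖ ^ 2 ≤ (1 + s) * f X + (1 + s⁻¹) * g X := fun X =>
      young_aux (Ψ.ψ X) c hs
    have hlin : ∫ X in cellN N L, ((1 + s) * f X + (1 + s⁻¹) * g X) = (1 + s) + (1 + s⁻¹) * κ' := by
      rw [integral_add (if_.const_mul _) (ig.const_mul _), integral_const_mul, integral_const_mul, hIf]
      ring
    have hconst : ∫ X in cellN N L, ‖c‖ ^ 2 = ‖c‖ ^ 2 * V := by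
      rw [setIntegral_const, hVol, smul_eq_mul]; ring
    calc ‖c‖ ^ 2 * V = ∫ X in cellN N L, ‖c‖ ^ 2 := hconst.symm
      _ ≤ ∫ X in cellN N L, ((1 + s) * f X + (1 + s⁻¹) * g X) :=
          setIntegral_mono (integrableOn_const hfin) ((if_.const_mul _).add (ig.const_mul _)) hpt
      _ = (1 + s) + (1 + s⁻¹) * κ' := hlin
      _ ≤ (1 + s) + (1 + s⁻¹) * κ := by gcongr

/-- **Phase alignment**: rotating `c'` by `arg c − arg c'` leaves the distance `| |c| − |c'| |` to `c`. [folklore] -/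
theorem norm_sub_argPhase_mul (c c' : ℂ) :
    ‖c - Complex.exp (((Complex.arg c - Complex.arg c' : ℝ) : ℂ) * Complex.I) * c'‖ = |‖c‖ - ‖c'‖| := by
  have hc : (‖c‖ : ℂ) * Complex.exp (Complex.arg c * Complex.I) = c := Complex.norm_mul_exp_arg_mul_I c
  have hc' : (‖c'‖ : ℂ) * Complex.exp (Complex.arg c' * Complex.I) = c' := Complex.norm_mul_exp_arg_mul_I c'
  have hsplit : ((Complex.arg c - Complex.arg c' : ℝ) : ℂ) * Complex.I =
      Complex.arg c * Complex.I + -(Complex.arg c' * Complex.I) := by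
    push_cast; ring
  have key' : Complex.exp (((Complex.arg c - Complex.arg c' : ℝ) : ℂ) * Complex.I) *
      ((‖c'‖ : ℂ) * Complex.exp (Complex.arg c' * Complex.I)) =
      (‖c'‖ : ℂ) * Complex.exp (Complex.arg c * Complex.I) := by
    rw [hsplit, Complex.exp_add, Complex.exp_neg]
    have hne : Complex.exp (Complex.arg c' * Complex.I) ≠ 0 := Complex.exp_ne_zero _
    field_simp
  have key : Complex.exp (((Complex.arg c - Complex.arg c' : ℝ) : ℂ) * Complex.I) * c' =
      (‖c'‖ : ℂ) * Complex.exp (Complex.arg c * Complex.I) := by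
    rw [hc'] at key'
    exact key'
  have hpolar : c - (‖c'‖ : ℂ) * Complex.exp (Complex.arg c * Complex.I) =
      ((‖c‖ : ℂ) - (‖c'‖ : ℂ)) * Complex.exp (Complex.arg c * Complex.I) := by
    rw [sub_mul, hc]
  rw [key, hpolar, norm_mul, Complex.norm_exp_ofReal_mul_I, mul_one, ← Complex.ofReal_sub,
    Complex.norm_real, Real.norm_eq_abs]

/-- `‖x + y + z‖² ≤ 3(‖x‖² + ‖y‖² + ‖z‖²)`. [folklore] -/
theorem norm_add_three_sq_le (x y z : ℂ) :
    ‖x + y + z‖ ^ 2 ≤ 3 * (‖x‖ ^ 2 + ‖y‖ ^ 2 + ‖z‖ ^ 2) := by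
  have h : ‖x + y + z‖ ≤ ‖x‖ + ‖y‖ + ‖z‖ := norm_add₃_le
  have h0 : 0 ≤ ‖x + y + z‖ := norm_nonneg _
  have h1 : ‖x + y + z‖ ^ 2 ≤ (‖x‖ + ‖y‖ + ‖z‖) ^ 2 := pow_le_pow_left₀ h0 h 2
  nlinarith [sq_nonneg (‖x‖ - ‖y‖), sq_nonneg (‖y‖ - ‖z‖), sq_nonneg (‖x‖ - ‖z‖)]

/-- **Near-constant states cluster modulo a phase.** If two periodic trial states are each within `t²` of a
constant in `L²(cell^N)` (`0 < t ≤ 1`), then after a phase rotation they are within `33t` of each other: the two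
constants have moduli with `|c|²V, |c'|²V ∈ [1 − 6t, (1+t)²]`, hence `V(|c|−|c'|)² ≤ 9t`. [folklore] -/
theorem nearConst_cluster (hL : 0 < L) (Φ Φ' : PeriodicTrialState N L) (c c' : ℂ) {t : ℝ}
    (ht : 0 < t) (ht1 : t ≤ 1)
    (hΦ : ∫ X in cellN N L, ‖Φ.ψ X - c‖ ^ 2 ≤ t ^ 2)
    (hΦ' : ∫ X in cellN N L, ‖Φ'.ψ X - c'‖ ^ 2 ≤ t ^ 2) :
    ∃ θ : ℝ, ∫ X in cellN N L, ‖Φ.ψ X - Complex.exp (θ * Complex.I) * Φ'.ψ X‖ ^ 2 ≤ 33 * t := by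
  set V : ℝ := (L ^ 3) ^ N with hVdef
  have hV : 0 < V := by positivity
  obtain ⟨h1, h2⟩ := mass_bounds_of_near_const hL Φ c ht hΦ
  obtain ⟨h1', h2'⟩ := mass_bounds_of_near_const hL Φ' c' ht hΦ'
  have hst : (1 + t⁻¹) * t ^ 2 = t + t ^ 2 := by field_simp; ring
  rw [hst] at h1 h2 h1' h2'
  set u : ℝ := ‖c‖ ^ 2 * V with hu
  set u' : ℝ := ‖c'‖ ^ 2 * V with hu'
  have hu0 : 0 ≤ u := by positivity
  have hu0' : 0 ≤ u' := by positivity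
  -- `u, u' ∈ [1 - 6t, 1 + 2t + t²]`, so `|u - u'| ≤ 9t`
  have htt : t ^ 2 ≤ t := by nlinarith
  have httt : t * t ^ 2 ≤ t * t := mul_le_mul_of_nonneg_left htt ht.le
  have hlow : 1 - 6 * t ≤ u := by nlinarith [mul_le_mul_of_nonneg_left h2 ht.le]
  have hlow' : 1 - 6 * t ≤ u' := by nlinarith [mul_le_mul_of_nonneg_left h2' ht.le]
  have hdiff : |u - u'| ≤ 9 * t := by
    rw [abs_le]
    constructor <;> nlinarith
  -- `V (|c| - |c'|)² ≤ |u - u'|`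
  have hcc : (‖c‖ - ‖c'‖) ^ 2 * V ≤ |u - u'| := by
    have ha : 0 ≤ ‖c‖ := norm_nonneg _
    have hb : 0 ≤ ‖c'‖ := norm_nonneg _
    have hfac : u - u' = ((‖c‖ - ‖c'‖) * V) * (‖c‖ + ‖c'‖) := by rw [hu, hu']; ring
    rw [hfac, abs_mul, abs_mul, abs_of_pos hV]
    have hle : |‖c‖ - ‖c'‖| ≤ |‖c‖ + ‖c'‖| := by
      rw [abs_of_nonneg (by positivity : (0 : ℝ) ≤ ‖c‖ + ‖c'‖), abs_le]
      constructor <;> linarith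
    calc (‖c‖ - ‖c'‖) ^ 2 * V = |‖c‖ - ‖c'‖| * V * |‖c‖ - ‖c'‖| := by rw [← sq_abs]; ring
      _ ≤ |‖c‖ - ‖c'‖| * V * |‖c‖ + ‖c'‖| := by gcongr
  -- the phase
  set θ : ℝ := Complex.arg c - Complex.arg c' with hθ
  refine ⟨θ, ?_⟩
  have hmid : ‖c - Complex.exp ((θ : ℂ) * Complex.I) * c'‖ = |‖c‖ - ‖c'‖| := norm_sub_argPhase_mul c c'
  have hpt : ∀ X, ‖Φ.ψ X - Complex.exp ((θ : ℂ) * Complex.I) * Φ'.ψ X‖ ^ 2 ≤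
      3 * (‖Φ.ψ X - c‖ ^ 2 + (‖c‖ - ‖c'‖) ^ 2 + ‖Φ'.ψ X - c'‖ ^ 2) := by
    intro X
    have hsplit : Φ.ψ X - Complex.exp ((θ : ℂ) * Complex.I) * Φ'.ψ X =
        (Φ.ψ X - c) + (c - Complex.exp ((θ : ℂ) * Complex.I) * c') +
          Complex.exp ((θ : ℂ) * Complex.I) * (c' - Φ'.ψ X) := by ring
    rw [hsplit]
    refine (norm_add_three_sq_le _ _ _).trans (le_of_eq ?_)
    rw [hmid, sq_abs, norm_mul, Complex.norm_exp_ofReal_mul_I, one_mul, norm_sub_rev c' (Φ'.ψ X)]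
  -- integrate
  have hΦc : Continuous Φ.ψ := Φ.contDiff.continuous
  have hΦ'c : Continuous Φ'.ψ := Φ'.contDiff.continuous
  have i1 : IntegrableOn (fun X => ‖Φ.ψ X - c‖ ^ 2) (cellN N L) volume :=
    integrableOn_cellN_real L (((hΦc.sub continuous_const).norm).pow 2)
  have i3 : IntegrableOn (fun X => ‖Φ'.ψ X - c'‖ ^ 2) (cellN N L) volume :=
    integrableOn_cellN_real L (((hΦ'c.sub continuous_const).norm).pow 2)
  have hfin : volume (cellN N L) ≠ ⊤ := by
    rw [volume_cellN]; exact ENNReal.pow_ne_top (ENNReal.pow_ne_top ENNReal.ofReal_ne_top)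
  have i2 : IntegrableOn (fun _ : Config N => (‖c‖ - ‖c'‖) ^ 2) (cellN N L) volume := integrableOn_const hfin
  have iL : IntegrableOn (fun X => ‖Φ.ψ X - Complex.exp ((θ : ℂ) * Complex.I) * Φ'.ψ X‖ ^ 2) (cellN N L) volume :=
    integrableOn_cellN_real L (((hΦc.sub (continuous_const.mul hΦ'c)).norm).pow 2)
  have hVol : (volume : Measure (Config N)).real (cellN N L) = V := measureReal_cellN hL N
  have i12 : IntegrableOn (fun X => ‖Φ.ψ X - c‖ ^ 2 + (‖c‖ - ‖c'‖) ^ 2) (cellN N L) volume := i1.add i2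
  have i123 : IntegrableOn (fun X => ‖Φ.ψ X - c‖ ^ 2 + (‖c‖ - ‖c'‖) ^ 2 + ‖Φ'.ψ X - c'‖ ^ 2)
      (cellN N L) volume := i12.add i3
  have hlin : ∫ X in cellN N L, 3 * (‖Φ.ψ X - c‖ ^ 2 + (‖c‖ - ‖c'‖) ^ 2 + ‖Φ'.ψ X - c'‖ ^ 2) =
      3 * ((∫ X in cellN N L, ‖Φ.ψ X - c‖ ^ 2) + (‖c‖ - ‖c'‖) ^ 2 * V +
        ∫ X in cellN N L, ‖Φ'.ψ X - c'‖ ^ 2) := by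
    rw [integral_const_mul, integral_add i12 i3, integral_add i1 i2, setIntegral_const, hVol,
      smul_eq_mul]
    ring
  calc ∫ X in cellN N L, ‖Φ.ψ X - Complex.exp ((θ : ℂ) * Complex.I) * Φ'.ψ X‖ ^ 2
      ≤ ∫ X in cellN N L, 3 * (‖Φ.ψ X - c‖ ^ 2 + (‖c‖ - ‖c'‖) ^ 2 + ‖Φ'.ψ X - c'‖ ^ 2) :=
        setIntegral_mono iL (i123.const_mul 3) hpt
    _ = 3 * ((∫ X in cellN N L, ‖Φ.ψ X - c‖ ^ 2) + (‖c‖ - ‖c'‖) ^ 2 * V +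
          ∫ X in cellN N L, ‖Φ'.ψ X - c'‖ ^ 2) := hlin
    _ ≤ 3 * (t ^ 2 + 9 * t + t ^ 2) := by
        have hm : (‖c‖ - ‖c'‖) ^ 2 * V ≤ 9 * t := hcc.trans hdiff
        gcongr
    _ ≤ 33 * t := by nlinarith

/-- **S5 `stub_diluteClustering` HOLDS AT THE FREE GAS** (the `v = 0` instance of the picked line's simplicity stub,
and the mechanism of F at `v → 0`): at every density, for every `N ≥ 1`, `E₀^per(0) = 0 ≠ ⊤`, and for `η > 0` the
slack `δ = π²t²/L²`, `t = min(1, η/33)`, makes any two `δ`-near-minimisers of the free periodic energy `η`-close in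
`L²(cell^N)` modulo a phase (Poincaré gap of the cell + `nearConst_cluster`). The configuration space of the free
gas is trivially connected; the content of §13 is that at `v = hardCorePotential b` the same statement rests on
`LemmaGConnected`. [folklore] -/
theorem diluteClustering_holds_at_freeGas :
    ∃ ρ₁ : ℝ, 0 < ρ₁ ∧ ∀ ρ : ℝ, 0 < ρ → ρ < ρ₁ → ∀ᶠ N : ℕ in atTop,
      periodicGroundStateEnergy (0 : ℝ → ℝ≥0∞) N (sideLength ρ N) ≠ ⊤ ∧
      ∀ η : ℝ, 0 < η → ∃ δ : ℝ≥0∞, 0 < δ ∧ ∀ Φ Φ' : PeriodicTrialState N (sideLength ρ N),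
        periodicEnergy (0 : ℝ → ℝ≥0∞) Φ ≤
            periodicGroundStateEnergy (0 : ℝ → ℝ≥0∞) N (sideLength ρ N) + δ →
        periodicEnergy (0 : ℝ → ℝ≥0∞) Φ' ≤
            periodicGroundStateEnergy (0 : ℝ → ℝ≥0∞) N (sideLength ρ N) + δ →
        ∃ θ : ℝ, ∫ X in cellN N (sideLength ρ N),
          ‖Φ.ψ X - Complex.exp (θ * Complex.I) * Φ'.ψ X‖ ^ 2 ≤ η := by
  refine ⟨1, one_pos, fun ρ hρ _ => ?_⟩
  filter_upwards [eventually_gt_atTop 0] with N hN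
  have hL : 0 < sideLength ρ N := sideLength_pos_of_pos hρ hN
  refine ⟨by rw [periodicGroundStateEnergy_zero_eq_zero N hL]; exact ENNReal.zero_ne_top, fun η hη => ?_⟩
  set t : ℝ := min 1 (η / 33) with htdef
  have ht : 0 < t := lt_min one_pos (by positivity)
  have ht1 : t ≤ 1 := min_le_left _ _
  have ht33 : 33 * t ≤ η := by
    have := min_le_right 1 (η / 33)
    rw [← htdef] at this
    linarith
  refine ⟨ENNReal.ofReal (Real.pi ^ 2 / sideLength ρ N ^ 2 * t ^ 2),
    ENNReal.ofReal_pos.2 (by positivity), fun Φ Φ' hΦ hΦ' => ?_⟩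
  obtain ⟨c, hc⟩ := exists_near_const_of_kinetic_le' hL Φ (sq_nonneg t)
    (kinetic_le_free_aux hL Φ hΦ)
  obtain ⟨c', hc'⟩ := exists_near_const_of_kinetic_le' hL Φ' (sq_nonneg t)
    (kinetic_le_free_aux hL Φ' hΦ')
  obtain ⟨θ, hθ⟩ := nearConst_cluster hL Φ Φ' c c' ht ht1 hc hc'
  exact ⟨θ, hθ.trans ht33⟩

end FreeClustering

end Summit.AtomisticToContinuum.BoseEinsteinCondensation.Theorems.HardCoreExtension.Negative

end
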